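import Literature.NumberTheory.LFunctions.RudnickSarnakNSliceSum
import Mathlib.Analysis.SpecialFunctions.Integrals.Basic
import HarnessLib

/-!
# Rudnick–Sarnak `n`-level correlations for `ζ`: the `t`-averaged window of a clustered tuple

Sibling file of `Literature/NumberTheory/LFunctions/RudnickSarnak.lean` (toward
`Literature.NumberTheory.LFunctions.rudnick_sarnak_unrestricted`, Rudnick–Sarnak 1996, Theorem 3.2
for `ζ`, at every level; back end). The windowed sums of the front end weight each `n`-tuple of
ordinates by `K_T(γ) = ∫_0^T Π_j κ(t − γ_j) dt` (`RudnickSarnakN.winKer`); for the passage to the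
sharp sums (Rudnick–Sarnak 1996, pp. 302–303, where the cut-offs `h_j` are replaced by
characteristic functions) one needs to know that this weight is essentially a constant on the
tuples that matter: if `γ_0 ∈ [R, T − R]` and all `|γ_j − γ_0| ≤ ρ`, then

  `|K_T(γ) − c(R)| ≤ κ(0)^k (2C_κ/R + (k+1) κ(0) R ρ / 2)`,   `c(R) = ∫_{−R}^{R} κ^{k+1}`

(`RudnickSarnakN.Unsmooth.abs_winKer_sub_cR_le`), with `c(R) → c = ∫_ℝ κ^{k+1}`
(`RudnickSarnakN.Unsmooth.tendsto_cR`). Ingredients: `κ` is Lipschitz with constant `κ(0)/4`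
(`RudnickSarnakN.Unsmooth.abs_ker_sub_ker_le`, from `κ(r) = ∫ g₀(v) e^{irv} dv`, `supp g₀ ⊆ [−1/4, 1/4]`),
the decay `κ ≤ C_κ/(1 + r²)²`, and the elementary `∫_R^∞ dt/(1+t²) ≤ 1/R`. Also recorded: the sum of
`κ(t − γ)` over the zeros *above* a height `T ≥ t` is `≪ log(T+2)/(1 + (T − t)²)`
(`RudnickSarnakN.Unsmooth.sum_ker_far_le`), which makes the zeros above `T + 3` negligible in `W(T)`.

## References

* Z. Rudnick, P. Sarnak, *Zeros of principal `L`-functions and random matrix theory*, Duke Math.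
  J. 81 (1996), 269–322, pp. 302–304.
* H. L. Montgomery, *The pair correlation of zeros of the zeta function* (1973), §2 (the
  `t`-average).
-/

noncomputable section

open Complex Filter Set MeasureTheory Finset intervalIntegral
open scoped Real Topology

namespace Literature.NumberTheory.LFunctions

namespace RudnickSarnakN

namespace Unsmooth

variable {k : ℕ}

/-! ## `κ` is Lipschitz -/

/-- `∫ ‖g₀‖ = κ(0)`. [folklore] -/
theorem integral_norm_g0 : ∫ v, ‖g0 v‖ = ker 0 := by
  have h1 : ∫ v, ‖g0 v‖ = ∫ v, (g0 v).re := integral_congr_ae (Eventually.of_forall norm_g0)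
  rw [h1, ← re_integral_eq integrable_g0, ← ker_zero_eq, Complex.ofReal_re]

/-- **`κ` is Lipschitz**: `|κ(a) − κ(b)| ≤ (κ(0)/4) |a − b|`
(`κ(a) − κ(b) = ∫ g₀(v)(e^{iav} − e^{ibv}) dv`, `|e^{iav} − e^{ibv}| ≤ |a − b| |v| ≤ |a − b|/4` on
`supp g₀ ⊆ [−1/4, 1/4]`). [folklore] -/
theorem abs_ker_sub_ker_le (a b : ℝ) : |ker a - ker b| ≤ ker 0 / 4 * |a - b| := by
  have hia : Integrable fun v : ℝ ↦ g0 v * cexp (a * v * I) := by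
    refine (integrable_g0.norm.mono' (integrable_g0.aestronglyMeasurable.mul ?_) ?_)
    · exact (Complex.continuous_exp.comp ((continuous_const.mul Complex.continuous_ofReal).mul
        continuous_const)).aestronglyMeasurable
    · refine Eventually.of_forall fun v ↦ ?_
      rw [norm_mul, show (a : ℂ) * v * I = ((a * v : ℝ) : ℂ) * I by push_cast; ring, Complex.norm_exp_ofReal_mul_I, mul_one]
  have hib : Integrable fun v : ℝ ↦ g0 v * cexp (b * v * I) := by
    refine (integrable_g0.norm.mono' (integrable_g0.aestronglyMeasurable.mul ?_) ?_)
    · exact (Complex.continuous_exp.comp ((continuous_const.mul Complex.continuous_ofReal).mul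
        continuous_const)).aestronglyMeasurable
    · refine Eventually.of_forall fun v ↦ ?_
      rw [norm_mul, show (b : ℂ) * v * I = ((b * v : ℝ) : ℂ) * I by push_cast; ring, Complex.norm_exp_ofReal_mul_I, mul_one]
  have hdiff : ((ker a - ker b : ℝ) : ℂ) = ∫ v : ℝ, g0 v * (cexp (a * v * I) - cexp (b * v * I)) := by
    push_cast
    rw [ker_eq_integral, ker_eq_integral, ← integral_sub hia hib]
    congr 1 with v
    ring
  have hpt : ∀ v : ℝ, ‖g0 v * (cexp (a * v * I) - cexp (b * v * I))‖ ≤ |a - b| / 4 * ‖g0 v‖ := by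
    intro v
    rw [norm_mul, mul_comm]
    by_cases hv : 1 / 4 ≤ |v|
    · rw [g0_eq_zero hv, norm_zero, mul_zero, mul_zero]
    · refine mul_le_mul_of_nonneg_right ?_ (norm_nonneg _)
      have hv' : |v| ≤ 1 / 4 := (not_le.1 hv).le
      have h1 : cexp (a * v * I) - cexp (b * v * I) = cexp (b * v * I) * (cexp (I * (((a - b) * v : ℝ) : ℂ)) - 1) := by
        rw [mul_sub, mul_one, ← Complex.exp_add]
        congr 2
        push_cast
        ring
      rw [h1, norm_mul, show (b : ℂ) * v * I = ((b * v : ℝ) : ℂ) * I by push_cast; ring,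
        Complex.norm_exp_ofReal_mul_I, one_mul]
      refine (Real.norm_exp_I_mul_ofReal_sub_one_le).trans ?_
      rw [Real.norm_eq_abs, abs_mul]
      calc |a - b| * |v| ≤ |a - b| * (1 / 4) := mul_le_mul_of_nonneg_left hv' (abs_nonneg _)
        _ = |a - b| / 4 := by ring
  have hnorm : ‖((ker a - ker b : ℝ) : ℂ)‖ ≤ |a - b| / 4 * ker 0 := by
    rw [hdiff, ← integral_norm_g0, ← MeasureTheory.integral_const_mul]
    exact norm_integral_le_of_norm_le (integrable_g0.norm.const_mul _) (Eventually.of_forall hpt)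
  rw [Complex.norm_real, Real.norm_eq_abs] at hnorm
  linarith

/-! ## Products of kernels -/

/-- Telescoping: if `0 ≤ a_j, b_j ≤ M` then `|Π_{s} a − Π_{s} b| ≤ M^{|s|−1} Σ_{s} |a_j − b_j|`. [folklore] -/
theorem abs_prod_sub_prod_le {ι : Type*} [DecidableEq ι] (s : Finset ι) (a b : ι → ℝ) {M : ℝ}
    (ha0 : ∀ j ∈ s, 0 ≤ a j) (haM : ∀ j ∈ s, a j ≤ M) (hb0 : ∀ j ∈ s, 0 ≤ b j) (hbM : ∀ j ∈ s, b j ≤ M) :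
    |∏ j ∈ s, a j - ∏ j ∈ s, b j| ≤ M ^ (s.card - 1) * ∑ j ∈ s, |a j - b j| := by
  induction s using Finset.induction_on with
  | empty => simp
  | insert i s hi ih =>
    have ha0' : ∀ j ∈ s, 0 ≤ a j := fun j hj ↦ ha0 j (Finset.mem_insert_of_mem hj)
    have haM' : ∀ j ∈ s, a j ≤ M := fun j hj ↦ haM j (Finset.mem_insert_of_mem hj)
    have hb0' : ∀ j ∈ s, 0 ≤ b j := fun j hj ↦ hb0 j (Finset.mem_insert_of_mem hj)
    have hbM' : ∀ j ∈ s, b j ≤ M := fun j hj ↦ hbM j (Finset.mem_insert_of_mem hj)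
    have hih := ih ha0' haM' hb0' hbM'
    have hai0 := ha0 i (Finset.mem_insert_self i s)
    have haiM := haM i (Finset.mem_insert_self i s)
    have hbi0 := hb0 i (Finset.mem_insert_self i s)
    have hbiM := hbM i (Finset.mem_insert_self i s)
    have hM0 : 0 ≤ M := hai0.trans haiM
    rw [Finset.prod_insert hi, Finset.prod_insert hi, Finset.sum_insert hi, Finset.card_insert_of_notMem hi]
    simp only [Nat.add_sub_cancel]
    have hPa : 0 ≤ ∏ j ∈ s, a j := Finset.prod_nonneg ha0'
    have hPaM : ∏ j ∈ s, a j ≤ M ^ s.card := by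
      rw [← Finset.prod_const]; exact Finset.prod_le_prod ha0' haM'
    have hsum0 : 0 ≤ ∑ j ∈ s, |a j - b j| := Finset.sum_nonneg fun j _ ↦ abs_nonneg _
    -- `a_i A − b_i B = (a_i − b_i) A + b_i (A − B)`
    have hsplit : a i * ∏ j ∈ s, a j - b i * ∏ j ∈ s, b j =
        (a i - b i) * ∏ j ∈ s, a j + b i * (∏ j ∈ s, a j - ∏ j ∈ s, b j) := by ring
    rw [hsplit]
    refine (abs_add_le _ _).trans ?_
    rw [abs_mul, abs_mul, abs_of_nonneg hPa, abs_of_nonneg hbi0]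
    rcases s.eq_empty_or_nonempty with rfl | hne
    · simp
    · have hcard : 1 ≤ s.card := Finset.card_pos.2 hne
      have hpow : M ^ s.card = M * M ^ (s.card - 1) := by
        rw [← pow_succ']; congr 1; omega
      calc |a i - b i| * ∏ j ∈ s, a j + b i * |∏ j ∈ s, a j - ∏ j ∈ s, b j|
          ≤ |a i - b i| * M ^ s.card + M * (M ^ (s.card - 1) * ∑ j ∈ s, |a j - b j|) :=
            add_le_add (mul_le_mul_of_nonneg_left hPaM (abs_nonneg _)) (mul_le_mul hbiM hih (abs_nonneg _) hM0)
        _ = M ^ s.card * (|a i - b i| + ∑ j ∈ s, |a j - b j|) := by rw [hpow]; ring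

/-- **Clustered tuples**: if all `|γ_j − γ_0| ≤ ρ` then
`|Π_j κ(t − γ_j) − κ(t − γ_0)^{k+1}| ≤ (k+1) κ(0)^k (κ(0)/4) ρ`. [folklore] -/
theorem abs_prod_ker_sub_pow_le (t : ℝ) (γ : Fin (k + 1) → ℝ) {ρ : ℝ} (hρ : ∀ j, |γ j - γ 0| ≤ ρ) :
    |∏ j, ker (t - γ j) - ker (t - γ 0) ^ (k + 1)| ≤ (k + 1) * ker 0 ^ k * (ker 0 / 4 * ρ) := by
  have h := abs_prod_sub_prod_le (Finset.univ : Finset (Fin (k + 1))) (fun j ↦ ker (t - γ j)) (fun _ ↦ ker (t - γ 0))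
    (M := ker 0) (fun j _ ↦ ker_nonneg _) (fun j _ ↦ ker_le_ker_zero _) (fun j _ ↦ ker_nonneg _)
    (fun j _ ↦ ker_le_ker_zero _)
  rw [Finset.prod_const, Finset.card_univ, Fintype.card_fin] at h
  simp only [Nat.add_sub_cancel] at h
  refine h.trans ?_
  have hterm : ∀ j : Fin (k + 1), |ker (t - γ j) - ker (t - γ 0)| ≤ ker 0 / 4 * ρ := fun j ↦ by
    refine (abs_ker_sub_ker_le _ _).trans (mul_le_mul_of_nonneg_left ?_ (by linarith [ker_zero_pos]))
    rw [show t - γ j - (t - γ 0) = -(γ j - γ 0) by ring, abs_neg]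
    exact hρ j
  calc ker 0 ^ k * ∑ j, |ker (t - γ j) - ker (t - γ 0)| ≤ ker 0 ^ k * ∑ _j : Fin (k + 1), ker 0 / 4 * ρ :=
        mul_le_mul_of_nonneg_left (Finset.sum_le_sum fun j _ ↦ hterm j) (pow_nonneg (ker_nonneg 0) _)
    _ = (k + 1) * ker 0 ^ k * (ker 0 / 4 * ρ) := by
        rw [Finset.sum_const, Finset.card_univ, Fintype.card_fin, nsmul_eq_mul]; push_cast; ring

/-- `Π_j κ(t − γ_j) ≤ κ(0)^k κ(t − γ_0)`. [folklore] -/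
theorem prod_ker_le (t : ℝ) (γ : Fin (k + 1) → ℝ) : ∏ j, ker (t - γ j) ≤ ker 0 ^ k * ker (t - γ 0) := by
  rw [Fin.prod_univ_succ, mul_comm]
  refine mul_le_mul_of_nonneg_right ?_ (ker_nonneg _)
  calc ∏ i : Fin k, ker (t - γ i.succ) ≤ ∏ _i : Fin k, ker 0 :=
        Finset.prod_le_prod (fun i _ ↦ ker_nonneg _) fun i _ ↦ ker_le_ker_zero _
    _ = ker 0 ^ k := by simp

/-! ## Tails of the kernel -/

/-- The decay constant `C_κ` of `κ ≤ C_κ/(1 + r²)²`, chosen once. [folklore] -/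
def kerC : ℝ := Classical.choose exists_ker_le

/-- `0 < C_κ` and `κ(r) ≤ C_κ/(1+r²)²`. [folklore] -/
theorem kerC_spec : 0 < kerC ∧ ∀ r : ℝ, ker r ≤ kerC / (1 + r ^ 2) ^ 2 := Classical.choose_spec exists_ker_le

/-- `κ(r) ≤ C_κ/(1 + r²)`. [folklore] -/
theorem ker_le_div (r : ℝ) : ker r ≤ kerC / (1 + r ^ 2) := by
  refine (kerC_spec.2 r).trans ?_
  have h1 : (1 : ℝ) ≤ 1 + r ^ 2 := by nlinarith [sq_nonneg r]
  exact div_le_div_of_nonneg_left kerC_spec.1.le (by positivity) (by nlinarith)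

/-- `∫_R^{S} dt/(1 + t²) ≤ 1/R` for `0 < R` (`= arctan S − arctan R ≤ π/2 − arctan R = arctan(1/R) ≤ 1/R`).
[folklore] -/
theorem integral_inv_one_add_sq_tail_le {R S : ℝ} (hR : 0 < R) :
    ∫ t in R..S, (1 + t ^ 2)⁻¹ ≤ 1 / R := by
  rw [integral_inv_one_add_sq]
  have h1 : Real.arctan S < π / 2 := Real.arctan_lt_pi_div_two S
  have h2 : π / 2 - Real.arctan R = Real.arctan R⁻¹ := (Real.arctan_inv_of_pos hR).symm
  have h3 : Real.arctan R⁻¹ ≤ R⁻¹ := by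
    have hpos : 0 < Real.arctan R⁻¹ := Real.arctan_pos.2 (inv_pos.2 hR)
    have h := Real.lt_tan hpos (Real.arctan_lt_pi_div_two _)
    rw [Real.tan_arctan] at h
    exact h.le
  rw [one_div]
  linarith

/-- **Right tail**: `∫_{γ_0+R}^{S} κ(t − γ_0) dt ≤ C_κ/R` for `γ_0 + R ≤ S`, `R > 0`. [folklore] -/
theorem integral_ker_right_tail_le {γ₀ R S : ℝ} (hR : 0 < R) (hS : γ₀ + R ≤ S) :
    ∫ t in (γ₀ + R)..S, ker (t - γ₀) ≤ kerC / R := by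
  have hc := kerC_spec.1
  have hcont : Continuous fun t : ℝ ↦ kerC * (1 + (t - γ₀) ^ 2)⁻¹ := by
    refine continuous_const.mul (Continuous.inv₀ ?_ ?_)
    · fun_prop
    · intro t; positivity
  have hsub := intervalIntegral.integral_comp_sub_right (fun t : ℝ ↦ (1 + t ^ 2)⁻¹) γ₀ (a := γ₀ + R) (b := S)
  simp only [add_sub_cancel_left] at hsub
  calc ∫ t in (γ₀ + R)..S, ker (t - γ₀) ≤ ∫ t in (γ₀ + R)..S, kerC * (1 + (t - γ₀) ^ 2)⁻¹ :=
        intervalIntegral.integral_mono_on hS ((continuous_ker.comp (continuous_id.sub continuous_const)).intervalIntegrable _ _)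
          (hcont.intervalIntegrable _ _) fun t _ ↦ by rw [← div_eq_mul_inv]; exact ker_le_div _
    _ = kerC * ∫ t in R..(S - γ₀), (1 + t ^ 2)⁻¹ := by
        rw [intervalIntegral.integral_const_mul, hsub]
    _ ≤ kerC * (1 / R) := mul_le_mul_of_nonneg_left (integral_inv_one_add_sq_tail_le (S := S - γ₀) hR) hc.le
    _ = kerC / R := by ring

/-- **Left tail**: `∫_{S}^{γ_0−R} κ(t − γ_0) dt ≤ C_κ/R` for `S ≤ γ_0 − R`, `R > 0`. [folklore] -/
theorem integral_ker_left_tail_le {γ₀ R S : ℝ} (hR : 0 < R) (hS : S ≤ γ₀ - R) :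
    ∫ t in S..(γ₀ - R), ker (t - γ₀) ≤ kerC / R := by
  -- reflect: `t ↦ 2γ₀ − t`
  have h := integral_ker_right_tail_le (γ₀ := γ₀) hR (S := 2 * γ₀ - S) (by linarith)
  have hrefl : ∫ t in S..(γ₀ - R), ker (t - γ₀) = ∫ t in (γ₀ + R)..(2 * γ₀ - S), ker (t - γ₀) := by
    have := intervalIntegral.integral_comp_sub_left (fun t ↦ ker (t - γ₀)) (2 * γ₀) (a := γ₀ + R) (b := 2 * γ₀ - S)
    rw [show 2 * γ₀ - (γ₀ + R) = γ₀ - R by ring, show 2 * γ₀ - (2 * γ₀ - S) = S by ring] at this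
    rw [← this]
    refine intervalIntegral.integral_congr fun t _ ↦ ?_
    rw [show 2 * γ₀ - t - γ₀ = -(t - γ₀) by ring, ker_neg]
  rw [hrefl]
  exact h

/-! ## The window of a clustered tuple -/

/-- The truncated window constant `c(R) = ∫_{−R}^{R} κ^{k+1}`. [folklore] -/
def cR (k : ℕ) (R : ℝ) : ℝ := ∫ s in (-R)..R, ker s ^ (k + 1)

/-- The window constant `c = ∫_ℝ κ^{k+1}` (the limit of the `n`-fold `t`-window of a tight cluster).
[cite: RudnickSarnak1996, (3.7)] -/
def cLim (k : ℕ) : ℝ := ∫ s, ker s ^ (k + 1)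

/-- `κ^{k+1}` is integrable on `ℝ`. [folklore] -/
theorem integrable_ker_pow (k : ℕ) : Integrable fun s : ℝ ↦ ker s ^ (k + 1) := by
  have hc := kerC_spec.1
  have hint : Integrable fun s : ℝ ↦ ker 0 ^ k * (kerC * (1 + s ^ 2)⁻¹) :=
    (integrable_inv_one_add_sq.const_mul kerC).const_mul _
  refine hint.mono' ((continuous_ker.pow _).aestronglyMeasurable) (Eventually.of_forall fun s ↦ ?_)
  rw [Real.norm_of_nonneg (pow_nonneg (ker_nonneg s) _), pow_succ]
  refine mul_le_mul (pow_le_pow_left₀ (ker_nonneg s) (ker_le_ker_zero s) _) ?_ (ker_nonneg s) (pow_nonneg (ker_nonneg 0) _)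
  rw [← div_eq_mul_inv]; exact ker_le_div s

/-- `c(R) → c` as `R → ∞`. [folklore] -/
theorem tendsto_cR (k : ℕ) : Tendsto (cR k) atTop (𝓝 (cLim k)) := by
  unfold cR cLim
  exact intervalIntegral_tendsto_integral (integrable_ker_pow k) tendsto_neg_atTop_atBot tendsto_id

/-- `0 ≤ c(R)` for `R ≥ 0`. [folklore] -/
theorem cR_nonneg (k : ℕ) {R : ℝ} (hR : 0 ≤ R) : 0 ≤ cR k R :=
  intervalIntegral.integral_nonneg (by linarith) fun s _ ↦ pow_nonneg (ker_nonneg s) _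

/-- `c(R) ≤ c`. [folklore] -/
theorem cR_le_cLim (k : ℕ) {R : ℝ} (hR : 0 ≤ R) : cR k R ≤ cLim k := by
  unfold cR cLim
  rw [intervalIntegral.integral_of_le (by linarith)]
  exact setIntegral_le_integral (integrable_ker_pow k) (Eventually.of_forall fun s ↦ pow_nonneg (ker_nonneg s) _)

/-- `0 < c`. [folklore] -/
theorem cLim_pos (k : ℕ) : 0 < cLim k := by
  unfold cLim
  refine (integral_pos_iff_support_of_nonneg (fun s ↦ pow_nonneg (ker_nonneg s) _) (integrable_ker_pow k)).2 ?_
  have hsub : Set.Ioo (-4 : ℝ) 4 ⊆ Function.support fun s : ℝ ↦ ker s ^ (k + 1) := by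
    intro s hs
    rw [Function.mem_support]
    refine pow_ne_zero _ (ne_of_gt (lt_of_lt_of_le (by linarith [ker_zero_pos]) (half_ker_zero_le ?_)))
    rw [abs_le]; exact ⟨hs.1.le, hs.2.le⟩
  exact lt_of_lt_of_le (by simp) (measure_mono hsub)

/-- The window constant used for uniform bounds: `K_T(γ) ≤ κ(0)^k c₁` with `c₁ = ∫ κ`-type bound; we
use the cruder `K_T(γ) ≤ κ(0)^k (2 C_κ + 2 κ(0))`-free form below only through `winKer_le`. [folklore] -/
theorem winKer_le_integral {T : ℝ} (hT : 0 ≤ T) (γ : Fin (k + 1) → ℝ) :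
    winKer T γ ≤ ker 0 ^ k * ∫ t in (0 : ℝ)..T, ker (t - γ 0) := by
  unfold winKer
  rw [← intervalIntegral.integral_const_mul]
  exact intervalIntegral.integral_mono_on hT ((continuous_prod_ker γ).intervalIntegrable _ _)
    ((continuous_const.mul (continuous_ker.comp (continuous_id.sub continuous_const))).intervalIntegrable _ _)
    fun t _ ↦ prod_ker_le t γ

/-- `∫_a^b κ(t − γ_0) dt ≤ 2 C_κ + 2 κ(0)` for any `a ≤ b` (split at `γ_0 ± 1`). [folklore] -/
theorem integral_ker_shift_le {a b : ℝ} (hab : a ≤ b) (γ₀ : ℝ) :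
    ∫ t in a..b, ker (t - γ₀) ≤ 2 * kerC + 2 * ker 0 := by
  have hc := kerC_spec.1
  have hk := ker_zero_pos
  have hii : ∀ x y : ℝ, IntervalIntegrable (fun t ↦ ker (t - γ₀)) volume x y :=
    fun x y ↦ (continuous_ker.comp (continuous_id.sub continuous_const)).intervalIntegrable _ _
  have hnn : ∀ x y : ℝ, x ≤ y → 0 ≤ ∫ t in x..y, ker (t - γ₀) :=
    fun x y hxy ↦ intervalIntegral.integral_nonneg hxy fun t _ ↦ ker_nonneg _
  -- extend to `[min a (γ₀-1), max b (γ₀+1)]` and split into three pieces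
  set a' := min a (γ₀ - 1)
  set b' := max b (γ₀ + 1)
  have h1 : ∫ t in a..b, ker (t - γ₀) ≤ ∫ t in a'..b', ker (t - γ₀) :=
    intervalIntegral.integral_mono_interval (min_le_left _ _) hab (le_max_left _ _)
      (Eventually.of_forall fun t ↦ ker_nonneg _) (hii _ _)
  refine h1.trans ?_
  have hsplit : ∫ t in a'..b', ker (t - γ₀) = (∫ t in a'..(γ₀ - 1), ker (t - γ₀)) +
      ((∫ t in (γ₀ - 1)..(γ₀ + 1), ker (t - γ₀)) + ∫ t in (γ₀ + 1)..b', ker (t - γ₀)) := by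
    rw [intervalIntegral.integral_add_adjacent_intervals (hii _ _) (hii _ _),
      intervalIntegral.integral_add_adjacent_intervals (hii _ _) (hii _ _)]
  rw [hsplit]
  have hL := integral_ker_left_tail_le (γ₀ := γ₀) one_pos (S := a') (min_le_right _ _)
  have hR := integral_ker_right_tail_le (γ₀ := γ₀) one_pos (S := b') (le_max_right _ _)
  have hM : ∫ t in (γ₀ - 1)..(γ₀ + 1), ker (t - γ₀) ≤ 2 * ker 0 := by
    calc ∫ t in (γ₀ - 1)..(γ₀ + 1), ker (t - γ₀) ≤ ∫ _t in (γ₀ - 1)..(γ₀ + 1), ker 0 :=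
          intervalIntegral.integral_mono_on (by linarith) (hii _ _) intervalIntegrable_const fun t _ ↦ ker_le_ker_zero _
      _ = 2 * ker 0 := by rw [intervalIntegral.integral_const, smul_eq_mul]; ring
  rw [div_one] at hL hR
  linarith

/-- **Uniform bound for the window**: `0 ≤ K_T(γ) ≤ κ(0)^k (2C_κ + 2κ(0))`. [folklore] -/
theorem winKer_le {T : ℝ} (hT : 0 ≤ T) (γ : Fin (k + 1) → ℝ) :
    winKer T γ ≤ ker 0 ^ k * (2 * kerC + 2 * ker 0) :=
  (winKer_le_integral hT γ).trans (mul_le_mul_of_nonneg_left (integral_ker_shift_le hT _) (pow_nonneg (ker_nonneg 0) _))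

/-- **The window of a clustered interior tuple is nearly constant**: if `R > 0`, `R ≤ γ_0 ≤ T − R`
and `|γ_j − γ_0| ≤ ρ` for all `j`, then
`|K_T(γ) − c(R)| ≤ κ(0)^k (2 C_κ/R) + 2R (k+1) κ(0)^k (κ(0)/4) ρ`. [cite: RudnickSarnak1996, pp. 302–303] -/
theorem abs_winKer_sub_cR_le {T R ρ : ℝ} (hR : 0 < R) {γ : Fin (k + 1) → ℝ} (hlo : R ≤ γ 0) (hhi : γ 0 ≤ T - R)
    (hρ : ∀ j, |γ j - γ 0| ≤ ρ) :
    |winKer T γ - cR k R| ≤ ker 0 ^ k * (2 * kerC / R) + 2 * R * ((k + 1) * ker 0 ^ k * (ker 0 / 4 * ρ)) := by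
  have hκ0 := ker_zero_pos
  have hii : ∀ x y : ℝ, IntervalIntegrable (fun t ↦ ∏ j, ker (t - γ j)) volume x y :=
    fun x y ↦ (continuous_prod_ker γ).intervalIntegrable _ _
  have hii1 : ∀ x y : ℝ, IntervalIntegrable (fun t ↦ ker (t - γ 0)) volume x y :=
    fun x y ↦ (continuous_ker.comp (continuous_id.sub continuous_const)).intervalIntegrable _ _
  set P : ℝ → ℝ := fun t ↦ ∏ j, ker (t - γ j)
  -- split `[0, T]` at `γ_0 ± R`
  have hsplit : winKer T γ = (∫ t in (0 : ℝ)..(γ 0 - R), P t) +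
      ((∫ t in (γ 0 - R)..(γ 0 + R), P t) + ∫ t in (γ 0 + R)..T, P t) := by
    unfold winKer
    rw [intervalIntegral.integral_add_adjacent_intervals (hii _ _) (hii _ _),
      intervalIntegral.integral_add_adjacent_intervals (hii _ _) (hii _ _)]
  -- the middle piece versus `c(R)`
  have hmid : |(∫ t in (γ 0 - R)..(γ 0 + R), P t) - cR k R| ≤ 2 * R * ((k + 1) * ker 0 ^ k * (ker 0 / 4 * ρ)) := by
    have hcR : cR k R = ∫ t in (γ 0 - R)..(γ 0 + R), ker (t - γ 0) ^ (k + 1) := by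
      unfold cR
      rw [intervalIntegral.integral_comp_sub_right (fun s ↦ ker s ^ (k + 1)) (γ 0)]
      simp
    have hii2 : ∀ x y : ℝ, IntervalIntegrable (fun t ↦ ker (t - γ 0) ^ (k + 1)) volume x y :=
      fun x y ↦ ((continuous_ker.comp (continuous_id.sub continuous_const)).pow (k + 1)).intervalIntegrable _ _
    rw [hcR, ← intervalIntegral.integral_sub (hii _ _) (hii2 _ _)]
    have hb := intervalIntegral.norm_integral_le_of_norm_le_const (a := γ 0 - R) (b := γ 0 + R)
      (f := fun t ↦ P t - ker (t - γ 0) ^ (k + 1)) (C := (k + 1) * ker 0 ^ k * (ker 0 / 4 * ρ))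
      (fun t _ ↦ by rw [Real.norm_eq_abs]; exact abs_prod_ker_sub_pow_le t γ hρ)
    rw [Real.norm_eq_abs, show γ 0 + R - (γ 0 - R) = 2 * R by ring, abs_of_pos (by linarith : (0 : ℝ) < 2 * R)] at hb
    linarith
  -- the two tails
  have htail1 : 0 ≤ ∫ t in (0 : ℝ)..(γ 0 - R), P t :=
    intervalIntegral.integral_nonneg (by linarith) fun t _ ↦ prod_ker_nonneg t γ
  have htail2 : 0 ≤ ∫ t in (γ 0 + R)..T, P t :=
    intervalIntegral.integral_nonneg (by linarith) fun t _ ↦ prod_ker_nonneg t γ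
  have htail1' : ∫ t in (0 : ℝ)..(γ 0 - R), P t ≤ ker 0 ^ k * (kerC / R) := by
    calc ∫ t in (0 : ℝ)..(γ 0 - R), P t ≤ ∫ t in (0 : ℝ)..(γ 0 - R), ker 0 ^ k * ker (t - γ 0) :=
          intervalIntegral.integral_mono_on (by linarith) (hii _ _) ((hii1 _ _).const_mul _) fun t _ ↦ prod_ker_le t γ
      _ = ker 0 ^ k * ∫ t in (0 : ℝ)..(γ 0 - R), ker (t - γ 0) := intervalIntegral.integral_const_mul _ _
      _ ≤ ker 0 ^ k * (kerC / R) :=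
          mul_le_mul_of_nonneg_left (integral_ker_left_tail_le hR (by linarith)) (pow_nonneg hκ0.le _)
  have htail2' : ∫ t in (γ 0 + R)..T, P t ≤ ker 0 ^ k * (kerC / R) := by
    calc ∫ t in (γ 0 + R)..T, P t ≤ ∫ t in (γ 0 + R)..T, ker 0 ^ k * ker (t - γ 0) :=
          intervalIntegral.integral_mono_on (by linarith) (hii _ _) ((hii1 _ _).const_mul _) fun t _ ↦ prod_ker_le t γ
      _ = ker 0 ^ k * ∫ t in (γ 0 + R)..T, ker (t - γ 0) := intervalIntegral.integral_const_mul _ _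
      _ ≤ ker 0 ^ k * (kerC / R) :=
          mul_le_mul_of_nonneg_left (integral_ker_right_tail_le hR (by linarith)) (pow_nonneg hκ0.le _)
  rw [hsplit]
  have e : ker 0 ^ k * (2 * kerC / R) = 2 * (ker 0 ^ k * (kerC / R)) := by ring
  rw [abs_le]
  constructor
  · have := (abs_le.1 hmid).1; nlinarith
  · have := (abs_le.1 hmid).2; nlinarith

/-! ## Zeros far above the window -/

/-- For `t ≤ T ≤ γ`: `(1 + (t − γ)²)² ≥ (1 + (T − t)²)(1 + (γ − T)²)`. [folklore] -/
theorem one_add_sq_sq_ge {t T γ : ℝ} (ht : t ≤ T) (hγ : T ≤ γ) :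
    (1 + (T - t) ^ 2) * (1 + (γ - T) ^ 2) ≤ (1 + (t - γ) ^ 2) ^ 2 := by
  have h1 : (T - t) ^ 2 ≤ (t - γ) ^ 2 := by nlinarith
  have h2 : (γ - T) ^ 2 ≤ (t - γ) ^ 2 := by nlinarith
  have h3 : 0 ≤ 1 + (T - t) ^ 2 := by positivity
  have h4 : 0 ≤ 1 + (γ - T) ^ 2 := by positivity
  calc (1 + (T - t) ^ 2) * (1 + (γ - T) ^ 2) ≤ (1 + (t - γ) ^ 2) * (1 + (t - γ) ^ 2) :=
        mul_le_mul (by linarith) (by linarith) h4 (by positivity)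
    _ = (1 + (t - γ) ^ 2) ^ 2 := by ring

/-- **Zeros above a height are negligible below it**: there is `A > 0` such that for all `t ≤ T`
and every finite set `S` of indices with `γ_n ≥ T` (`n ∈ S`),
`Σ_{n ∈ S} κ(t − γ_n) ≤ A log(|T| + 2)/(1 + (T − t)²)`. [cite: Goldston2005, (2.18)] -/
theorem exists_sum_ker_far_le :
    ∃ A : ℝ, 0 < A ∧ ∀ (t T : ℝ), t ≤ T → ∀ S : Finset ℕ, (∀ n ∈ S, T ≤ zetaOrdinate n) →
      ∑ n ∈ S, ker (t - zetaOrdinate n) ≤ A * Real.log (|T| + 2) / (1 + (T - t) ^ 2) := by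
  obtain ⟨A₁, hA₁, hdens⟩ := Montgomery.exists_density_le
  have hc := kerC_spec.1
  refine ⟨kerC * A₁, by positivity, fun t T htT S hS ↦ ?_⟩
  have hpt : ∀ n ∈ S, ker (t - zetaOrdinate n) ≤
      kerC / (1 + (T - t) ^ 2) * (1 / (1 + (T - zetaOrdinate n) ^ 2)) := by
    intro n hn
    have hγ := hS n hn
    refine (kerC_spec.2 _).trans ?_
    rw [div_mul_div_comm, mul_one, show (T - zetaOrdinate n) ^ 2 = (zetaOrdinate n - T) ^ 2 by ring]
    exact div_le_div_of_nonneg_left hc.le (by positivity) (one_add_sq_sq_ge htT hγ)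
  calc ∑ n ∈ S, ker (t - zetaOrdinate n) ≤ ∑ n ∈ S, kerC / (1 + (T - t) ^ 2) * (1 / (1 + (T - zetaOrdinate n) ^ 2)) :=
        Finset.sum_le_sum hpt
    _ = kerC / (1 + (T - t) ^ 2) * ∑ n ∈ S, 1 / (1 + (T - zetaOrdinate n) ^ 2) := by rw [Finset.mul_sum]
    _ ≤ kerC / (1 + (T - t) ^ 2) * (A₁ * Real.log (|T| + 2)) := by
        refine mul_le_mul_of_nonneg_left ?_ (by positivity)
        exact ((hdens T).1.sum_le_tsum S (fun n _ ↦ by positivity)).trans (hdens T).2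
    _ = kerC * A₁ * Real.log (|T| + 2) / (1 + (T - t) ^ 2) := by ring

end Unsmooth

end RudnickSarnakN

end Literature.NumberTheory.LFunctions

end
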